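import Summits.AtomisticToContinuum.FouriersLaw.Theorems.VanishingNoiseTransferVanishingNoiseBoundNessGibbsDefect

/-!
# The weighted Duhamel bound for the pinned chain
(stub S2b `stub_nessFlipAsymmetryLipschitz`, line `fekete-usc-one-length`, brick 3)

`--supports stmt-AtomisticToContinuum-11976` helper file (crux `VanishingNoiseBound`, route
`VanishingNoiseTransfer`). For `pinnedChain ω₂ lam β γ` (`ω₂ > 0`, `lam, β, γ ≥ 0`, `N ≥ 1`,
`T_L, T_R > 0`), `f ∈ C²_c`, a MEASURABLE `g` with `|g| ≤ e^{ϑH}` (`0 < ϑ < 1/max(T_L,T_R)`) and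
`t > 0`:

* `pinnedChain_abs_integral_mul_transitionKernel_sub_le` —
  `|∫ f (P_t g - g) dx| ≤ t e^{2γt} e^{ϑγ(T_L+T_R)t} ∫ |L̂f + 2γf| e^{ϑH} dx`.

Proof: by Lebesgue duality `∫ f (P_t g) dx = e^{2γt} ∫ g (P̂_t f) dy`
(`integral_langevinKernel_duality`), so the left side is `∫ g (e^{2γt}P̂_t f - f) dy`; Duhamel for
the reversed kernels (`revKernel_duhamel`) bounds `|e^{2γt}P̂_t f - f|(y)` by
`e^{2γt} ∫₀ᵗ P̂_s|E|(y) ds`, `E = L̂f + 2γf`, and the weighted slices `∫ e^{ϑH} P̂_s|E| dy` are at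
most `e^{ϑγ(T_L+T_R)s} ∫ |E| e^{ϑH} dx` (`pinnedChain_lintegral_exp_mul_revKernel_le`). This is the
quantitative, WEIGHTED twin of `lintegral_abs_duhamel_le` (`…NessUniqueDuhamel.lean`, unweighted
`L¹`), and it is what makes an explicit stationary defect of a reference density transportable
along the semigroup for rough (measurable, `e^{ϑH}`-dominated) test functions. No definitions.
-/

noncomputable section

namespace Summit.AtomisticToContinuum.FouriersLaw.Theorems.FixedLengthNoiseContinuity

open MeasureTheory ProbabilityTheory Filter Topology Set
open scoped NNReal ENNReal ContDiff
open Literature.MathematicalPhysics.KineticTheory.HeatConduction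
open Literature.MathematicalPhysics.KineticTheory Literature.Probability.Process OscillatorChain
open Summit.AtomisticToContinuum.FouriersLaw.Theorems.SubdiffusiveBondHeat
open Summit.AtomisticToContinuum.FouriersLaw.Theorems.NessUnique

variable {N : ℕ}

/-! ## The weighted Duhamel bound -/

section Duhamel

variable {ω₂ lam β γ : ℝ} (hω : 0 < ω₂) (hl : 0 ≤ lam) (hβ : 0 ≤ β) (hγ : 0 ≤ γ) (hN : 0 < N)
  {T_L T_R : ℝ} (hTL : 0 < T_L) (hTR : 0 < T_R) {ϑ : ℝ} (hϑ : 0 < ϑ) (hϑ' : ϑ < 1 / max T_L T_R)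
include hω hl hβ hγ hN hTL hTR hϑ hϑ'

/-- **The weighted Duhamel bound.** For the pinned chain (`ω₂ > 0`, `lam, β, γ ≥ 0`, `N ≥ 1`,
`T_L, T_R > 0`), `f ∈ C²_c`, a MEASURABLE `g` with `|g| ≤ e^{ϑH}` (`0 < ϑ < 1/max(T_L,T_R)`) and `t > 0`:
`|∫ f (P_t g - g) dx| ≤ t e^{2γt} e^{ϑγ(T_L+T_R)t} ∫ |L̂f + 2γf| e^{ϑH} dx`. Proof: by Lebesgue
duality `∫ f (P_t g) dx = e^{2γt} ∫ g (P̂_t f) dy`, so the left side is `∫ g (e^{2γt}P̂_t f - f) dy`;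
Duhamel for the reversed kernels (`revKernel_duhamel`) bounds `|e^{2γt}P̂_t f - f|(y)` by
`e^{2γt} ∫₀ᵗ P̂_s|E|(y) ds`, `E = L̂f + 2γf`, and the weighted slices `∫ e^{ϑH} P̂_s|E| dy` are at
most `e^{ϑγ(T_L+T_R)s} ∫ |E| e^{ϑH} dx` (`pinnedChain_lintegral_exp_mul_revKernel_le`). [folklore] -/
theorem pinnedChain_abs_integral_mul_transitionKernel_sub_le
    {f : PhaseSpace N → ℝ} (hf : ContDiff ℝ 2 f) (hfc : HasCompactSupport f)
    {g : PhaseSpace N → ℝ} (hgm : Measurable g)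
    (hgb : ∀ y, |g y| ≤ Real.exp (ϑ * (pinnedChain ω₂ lam β γ).hamiltonian N y)) {t : ℝ≥0} (ht : 0 < t) :
    |∫ x, f x * ((∫ y, g y ∂((pinnedChain ω₂ lam β γ).transitionKernel N T_L T_R t x)) - g x)| ≤
      t * Real.exp (2 * γ * t) * Real.exp (ϑ * γ * (T_L + T_R) * t) *
        ∫ x, |sdeGenerator (fun z => -(pinnedChain ω₂ lam β γ).drift N z)
            ((pinnedChain ω₂ lam β γ).bathVecL N T_L) ((pinnedChain ω₂ lam β γ).bathVecR N T_R) f x +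
          2 * γ * f x| * Real.exp (ϑ * (pinnedChain ω₂ lam β γ).hamiltonian N x) := by
  set P := pinnedChain ω₂ lam β γ with hPdef
  have hP : P.IsConfining := pinnedChain_isConfining hω hl hβ hγ
  have hU := pinnedChain_contDiff_U ω₂ lam β γ (n := ((⊤ : ℕ∞) : WithTop ℕ∞))
  have hV := pinnedChain_contDiff_V ω₂ lam β γ (n := ((⊤ : ℕ∞) : WithTop ℕ∞))
  have hPγ : P.γ = γ := rfl
  set K : ℝ≥0 → Kernel (PhaseSpace N) (PhaseSpace N) := P.transitionKernel N T_L T_R with hKdef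
  have hKl : ∀ s, P.langevinKernel N T_L T_R s = K s := fun s =>
    pinnedChain_langevinKernel_eq_transitionKernel N T_L T_R hω hl hβ hγ s
  haveI hKprob : ∀ s x, IsProbabilityMeasure (K s x) := fun s x =>
    (pinnedChain_isMarkovKernel_transitionKernel hω hl hβ hγ N T_L T_R s).isProbabilityMeasure x
  set κ : ℝ≥0 → Kernel (PhaseSpace N) (PhaseSpace N) := P.langevinRevKernel N T_L T_R with hκ
  haveI hprob : ∀ s z, IsProbabilityMeasure (κ s z) := fun s z =>
    isProbabilityMeasure_langevinRevKernel hP N T_L T_R s z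
  set c := 2 * P.γ with hc
  have hc0 : 0 ≤ c := by rw [hc]; have := hP.γ_nonneg; positivity
  set Cs : ℝ := ϑ * γ * (T_L + T_R) with hCs
  have hCs0 : 0 ≤ Cs := by rw [hCs]; positivity
  -- the weight
  set Vr : PhaseSpace N → ℝ := fun y => Real.exp (ϑ * P.hamiltonian N y) with hVr
  have hHc : Continuous (P.hamiltonian N) := pinnedChain_continuous_hamiltonian ω₂ lam β γ N
  have hVc : Continuous Vr := by rw [hVr]; fun_prop
  have hV0 : ∀ y, 0 < Vr y := fun y => Real.exp_pos _
  have hVm : Measurable fun y => ENNReal.ofReal (Vr y) := hVc.measurable.ennreal_ofReal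
  -- the defect `E = L̂ f + c f`
  set Lf := sdeGenerator (fun z => -P.drift N z) (P.bathVecL N T_L) (P.bathVecR N T_R) f with hLf
  have hYc : Continuous fun z => -P.drift N z := (hP.reversedDrift N).contDiff_drift.continuous
  have hfcont : Continuous f := hf.continuous
  have hLc : Continuous Lf := continuous_sdeGenerator _ _ hYc hf
  obtain ⟨Cf, hCf⟩ := hfcont.bounded_above_of_compact_support hfc
  obtain ⟨CL, hCL⟩ := exists_bound_sdeGenerator (P.bathVecL N T_L) (P.bathVecR N T_R) hYc hf hfc
  set E : PhaseSpace N → ℝ := fun x => Lf x + c * f x with hE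
  have hEc : Continuous E := hLc.add (continuous_const.mul hfcont)
  have hEsupp : HasCompactSupport E := (hasCompactSupport_sdeGenerator _ _ hfc).add (hfc.mul_left)
  have hEb : ∀ x, ‖E x‖ ≤ CL + |c| * Cf := fun x => by
    calc ‖E x‖ ≤ ‖Lf x‖ + ‖c * f x‖ := norm_add_le _ _
      _ ≤ CL + |c| * Cf := by
          rw [norm_mul, Real.norm_eq_abs]
          exact add_le_add (hCL x) (mul_le_mul_of_nonneg_left (hCf x) (abs_nonneg c))
  have hmeasE : Measurable fun x => ENNReal.ofReal |E x| := hEc.abs.measurable.ennreal_ofReal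
  -- `W = ∫ |E| e^{ϑH} dx < ∞`
  have hEVi : Integrable (fun x => |E x| * Vr x) :=
    (hEc.abs.mul hVc).integrable_of_hasCompactSupport (hEsupp.abs.mul_right)
  have hW : ∫⁻ x, ENNReal.ofReal |E x| * ENNReal.ofReal (Vr x) = ENNReal.ofReal (∫ x, |E x| * Vr x) := by
    rw [ofReal_integral_eq_lintegral_ofReal hEVi (Eventually.of_forall fun x =>
      mul_nonneg (abs_nonneg _) (hV0 x).le)]
    refine lintegral_congr fun x => ?_
    rw [ENNReal.ofReal_mul (abs_nonneg _)]
  -- the transported absolute defect `a(s, y) = ∫ |E| dP̂_{s⁺}(y, ·)`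
  set a : ℝ → PhaseSpace N → ℝ := fun s y => ∫ x, |E x| ∂(κ s.toNNReal y) with ha
  have ha0 : ∀ s y, 0 ≤ a s y := fun s y => integral_nonneg fun x => abs_nonneg _
  have hac : ∀ y, Continuous fun s => a s y := fun y =>
    continuous_integral_langevinRevKernel hP N T_L T_R y hEc.abs (C := CL + |c| * Cf) fun x => by
      rw [Real.norm_eq_abs, abs_abs, ← Real.norm_eq_abs]; exact hEb x
  have ha_eq : ∀ s y, ENNReal.ofReal (a s y) = ∫⁻ x, ENNReal.ofReal |E x| ∂(κ s.toNNReal y) := by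
    intro s y
    rw [ha]
    exact ofReal_integral_eq_lintegral_ofReal
      ((integrable_const (CL + |c| * Cf)).mono' hEc.abs.aestronglyMeasurable
        (Eventually.of_forall fun x => by rw [Real.norm_eq_abs, abs_abs, ← Real.norm_eq_abs]; exact hEb x))
      (Eventually.of_forall fun x => abs_nonneg _)
  have hmeas : Measurable fun p : PhaseSpace N × ℝ => ENNReal.ofReal (a p.2 p.1) := by
    have e : (fun p : PhaseSpace N × ℝ => ENNReal.ofReal (a p.2 p.1)) =
        fun p => ∫⁻ x, ENNReal.ofReal |E x| ∂(P.langevinRevKernel N T_L T_R p.2.toNNReal p.1) :=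
      funext fun p => ha_eq p.2 p.1
    rw [e]
    exact measurable_lintegral_revKernel T_L T_R hP hmeasE
  -- pointwise Duhamel: `|e^{ct} P̂_t f - f|(y) ≤ e^{ct} ∫₀ᵗ a(s, y) ds`
  set D : PhaseSpace N → ℝ := fun y => Real.exp (c * t) * ∫ x, f x ∂(κ t y) - f y with hD
  have hpt : ∀ y, |D y| ≤ Real.exp (c * t) * ∫ s in (0:ℝ)..(t:ℝ), a s y := by
    intro y
    simp only [hD]
    rw [revKernel_duhamel T_L T_R hP hf hfc t y]
    have hle : ∀ s ∈ Set.Icc (0:ℝ) t, ‖Real.exp (c * s) * ∫ x, E x ∂(κ s.toNNReal y)‖ ≤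
        Real.exp (c * t) * a s y := by
      intro s hs
      rw [norm_mul, Real.norm_eq_abs, abs_of_pos (Real.exp_pos _)]
      refine mul_le_mul (Real.exp_le_exp.2 ?_) ?_ (norm_nonneg _) (Real.exp_pos _).le
      · exact mul_le_mul_of_nonneg_left hs.2 hc0
      · rw [Real.norm_eq_abs]
        exact abs_integral_le_integral_abs
    calc |∫ s in (0:ℝ)..(t:ℝ), Real.exp (c * s) * ∫ x, E x ∂(κ s.toNNReal y)|
        ≤ ∫ s in (0:ℝ)..(t:ℝ), Real.exp (c * t) * a s y := by
          rw [← Real.norm_eq_abs]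
          refine intervalIntegral.norm_integral_le_of_norm_le t.coe_nonneg ?_ ?_
          · exact Eventually.of_forall fun s hs => hle s ⟨hs.1.le, hs.2⟩
          · exact (continuous_const.mul (hac y)).intervalIntegrable _ _
      _ = Real.exp (c * t) * ∫ s in (0:ℝ)..(t:ℝ), a s y := by
          rw [intervalIntegral.integral_const_mul]
  have hconv : ∀ y, ENNReal.ofReal (Real.exp (c * t) * ∫ s in (0:ℝ)..(t:ℝ), a s y) =
      ENNReal.ofReal (Real.exp (c * t)) * ∫⁻ s in Set.Ioc (0:ℝ) t, ENNReal.ofReal (a s y) := by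
    intro y
    rw [ENNReal.ofReal_mul (Real.exp_pos _).le, intervalIntegral.integral_of_le t.coe_nonneg,
      ofReal_integral_eq_lintegral_ofReal]
    · exact ((hac y).integrableOn_Icc).mono_set Set.Ioc_subset_Icc_self
    · exact Eventually.of_forall fun s => ha0 s y
  -- weighted slices: `∫ e^{ϑH} a(s, ·) dy ≤ e^{Cs t} W` for `0 < s ≤ t`
  have hslice : ∀ s : ℝ, 0 < s → s ≤ t →
      ∫⁻ y, ENNReal.ofReal (Vr y) * ENNReal.ofReal (a s y) ≤
        ENNReal.ofReal (Real.exp (Cs * t)) * ENNReal.ofReal (∫ x, |E x| * Vr x) := by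
    intro s hs hst
    simp_rw [ha_eq]
    have h := pinnedChain_lintegral_exp_mul_revKernel_le hω hl hβ hγ hN hTL hTR hϑ hϑ' (s := s.toNNReal)
      (Real.toNNReal_pos.2 hs) hmeasE
    rw [hW] at h
    refine h.trans (mul_le_mul_left (ENNReal.ofReal_le_ofReal (Real.exp_le_exp.2 ?_)) _)
    rw [Real.coe_toNNReal _ hs.le, hCs]
    exact mul_le_mul_of_nonneg_left hst (by positivity)
  -- (B) the weighted `L¹` bound on `D` (`a` made opaque: its unfolding is expensive)
  clear_value a
  have hB : ∫⁻ y, ENNReal.ofReal (Vr y * |D y|) ≤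
      ENNReal.ofReal (Real.exp (c * t)) * (t * (ENNReal.ofReal (Real.exp (Cs * t)) *
        ENNReal.ofReal (∫ x, |E x| * Vr x))) := by
    have hmeas2 : Measurable fun p : PhaseSpace N × ℝ => ENNReal.ofReal (Vr p.1) * ENNReal.ofReal (a p.2 p.1) :=
      (hVm.comp measurable_fst).mul hmeas
    calc ∫⁻ y, ENNReal.ofReal (Vr y * |D y|)
        ≤ ∫⁻ y, ENNReal.ofReal (Vr y) * (ENNReal.ofReal (Real.exp (c * t)) *
            ∫⁻ s in Set.Ioc (0:ℝ) t, ENNReal.ofReal (a s y)) := by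
          refine lintegral_mono fun y => ?_
          rw [ENNReal.ofReal_mul (hV0 y).le, ← hconv y]
          exact mul_le_mul_right (ENNReal.ofReal_le_ofReal (hpt y)) _
      _ = ∫⁻ y, ENNReal.ofReal (Real.exp (c * t)) *
            ∫⁻ s in Set.Ioc (0:ℝ) t, ENNReal.ofReal (Vr y) * ENNReal.ofReal (a s y) := by
          refine lintegral_congr fun y => ?_
          have hmy : Measurable fun s => ENNReal.ofReal (a s y) :=
            hmeas.comp (measurable_const.prodMk measurable_id)
          rw [lintegral_const_mul (ENNReal.ofReal (Vr y)) hmy, ← mul_assoc, ← mul_assoc,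
            mul_comm (ENNReal.ofReal (Vr y))]
      _ = ENNReal.ofReal (Real.exp (c * t)) *
            ∫⁻ y, ∫⁻ s in Set.Ioc (0:ℝ) t, ENNReal.ofReal (Vr y) * ENNReal.ofReal (a s y) :=
          lintegral_const_mul' _ _ ENNReal.ofReal_ne_top
      _ = ENNReal.ofReal (Real.exp (c * t)) *
            ∫⁻ s in Set.Ioc (0:ℝ) t, ∫⁻ y, ENNReal.ofReal (Vr y) * ENNReal.ofReal (a s y) := by
          rw [lintegral_lintegral_swap hmeas2.aemeasurable]
      _ ≤ ENNReal.ofReal (Real.exp (c * t)) * ∫⁻ _ in Set.Ioc (0:ℝ) t,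
            ENNReal.ofReal (Real.exp (Cs * t)) * ENNReal.ofReal (∫ x, |E x| * Vr x) :=
          mul_le_mul_right (setLIntegral_mono' measurableSet_Ioc fun s hs => hslice s hs.1 hs.2) _
      _ = _ := by
          rw [setLIntegral_const, Real.volume_Ioc, sub_zero, ENNReal.ofReal_coe_nnreal]
          ring
  have hBfin : ∫⁻ y, ENNReal.ofReal (Vr y * |D y|) ≠ ⊤ :=
    ne_top_of_le_ne_top (ENNReal.mul_ne_top ENNReal.ofReal_ne_top (ENNReal.mul_ne_top ENNReal.coe_ne_top
      (ENNReal.mul_ne_top ENNReal.ofReal_ne_top ENNReal.ofReal_ne_top))) hB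
  -- measurability / integrability bookkeeping
  have hκf_meas : Measurable fun y => ∫ x, f x ∂(κ t y) :=
    (hfcont.stronglyMeasurable.integral_kernel (κ := κ t)).measurable
  have hDm : Measurable D := by
    rw [hD]; exact (measurable_const.mul hκf_meas).sub hfcont.measurable
  have hVDi : Integrable (fun y => Vr y * |D y|) := by
    refine ⟨(hVc.measurable.mul hDm.abs).aestronglyMeasurable, ?_⟩
    rw [hasFiniteIntegral_iff_ofReal (Eventually.of_forall fun y =>
      mul_nonneg (hV0 y).le (abs_nonneg _))]
    exact lt_top_iff_ne_top.2 hBfin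
  have hVK : ∀ (s : ℝ≥0) (x : PhaseSpace N), Integrable Vr (K s x) := fun s x =>
    pinnedChain_integrable_transitionKernel_of_abs_le_exp hω hl hβ hγ hN hTL hTR hϑ hϑ' s x hVc.measurable
      (fun y => by rw [abs_of_pos (hV0 y)])
  have hgK : ∀ x, Integrable g (K t x) := fun x =>
    pinnedChain_integrable_transitionKernel_of_abs_le_exp hω hl hβ hγ hN hTL hTR hϑ hϑ' t x hgm hgb
  set Kg : PhaseSpace N → ℝ := fun x => ∫ y, g y ∂(K t x) with hKg
  have hKgm : Measurable Kg := (hgm.stronglyMeasurable.integral_kernel (κ := K t)).measurable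
  have hKgb : ∀ x, |Kg x| ≤ Real.exp (Cs * t) * Vr x := fun x =>
    pinnedChain_abs_integral_transitionKernel_le hω hl hβ hγ hN hTL hTR hϑ hϑ' t x hgb
  -- `x ↦ f(x) (P_t g)(x)` and `x ↦ f(x) g(x)` are integrable (compact support of `f`)
  have hdom1 : Integrable (fun x => ‖f x‖ * (Real.exp (Cs * t) * Vr x)) :=
    (hfcont.norm.mul (continuous_const.mul hVc)).integrable_of_hasCompactSupport (hfc.norm.mul_right)
  have hfKg : Integrable (fun x => f x * Kg x) :=
    hdom1.mono' (hfcont.measurable.mul hKgm).aestronglyMeasurable (Eventually.of_forall fun x => by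
      rw [norm_mul, Real.norm_eq_abs (Kg x)]
      exact mul_le_mul_of_nonneg_left (hKgb x) (norm_nonneg _))
  have hdom2 : Integrable (fun x => ‖f x‖ * Vr x) :=
    (hfcont.norm.mul hVc).integrable_of_hasCompactSupport (hfc.norm.mul_right)
  have hfg : Integrable (fun x => f x * g x) :=
    hdom2.mono' (hfcont.measurable.mul hgm).aestronglyMeasurable (Eventually.of_forall fun x => by
      rw [norm_mul, Real.norm_eq_abs (g x)]
      exact mul_le_mul_of_nonneg_left (hgb x) (norm_nonneg _))
  -- `y ↦ g(y) (P̂_t f)(y)` is integrable (weighted slice with `φ = |f|`)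
  have hgκf : Integrable (fun y => g y * ∫ x, f x ∂(κ t y)) := by
    have hmf : Measurable fun x => ENNReal.ofReal |f x| := hfcont.abs.measurable.ennreal_ofReal
    have hsl := pinnedChain_lintegral_exp_mul_revKernel_le hω hl hβ hγ hN hTL hTR hϑ hϑ' ht hmf
    have hfVi : Integrable (fun x => |f x| * Vr x) :=
      (hfcont.abs.mul hVc).integrable_of_hasCompactSupport (hfc.abs.mul_right)
    have hfin : ∫⁻ x, ENNReal.ofReal |f x| * ENNReal.ofReal (Vr x) ≠ ⊤ := by
      have : ∫⁻ x, ENNReal.ofReal |f x| * ENNReal.ofReal (Vr x) = ENNReal.ofReal (∫ x, |f x| * Vr x) := by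
        rw [ofReal_integral_eq_lintegral_ofReal hfVi (Eventually.of_forall fun x =>
          mul_nonneg (abs_nonneg _) (hV0 x).le)]
        exact lintegral_congr fun x => by rw [ENNReal.ofReal_mul (abs_nonneg _)]
      rw [this]; exact ENNReal.ofReal_ne_top
    have hbound : ∀ y, ‖g y * ∫ x, f x ∂(κ t y)‖ ≤ Vr y * ∫ x, |f x| ∂(κ t y) := fun y => by
      rw [norm_mul, Real.norm_eq_abs, Real.norm_eq_abs]
      exact mul_le_mul (hgb y) abs_integral_le_integral_abs (abs_nonneg _) (hV0 y).le
    have hfi : ∀ y, Integrable (fun x => |f x|) (κ t y) := fun y =>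
      (integrable_const Cf).mono' hfcont.abs.aestronglyMeasurable (Eventually.of_forall fun x => by
        rw [Real.norm_eq_abs, abs_abs, ← Real.norm_eq_abs]; exact hCf x)
    have hmaj_m : Measurable fun y => Vr y * ∫ x, |f x| ∂(κ t y) :=
      hVc.measurable.mul (hfcont.abs.stronglyMeasurable.integral_kernel (κ := κ t)).measurable
    have hmaj : Integrable (fun y => Vr y * ∫ x, |f x| ∂(κ t y)) := by
      refine ⟨hmaj_m.aestronglyMeasurable, ?_⟩
      rw [hasFiniteIntegral_iff_ofReal (Eventually.of_forall fun y =>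
        mul_nonneg (hV0 y).le (integral_nonneg fun x => abs_nonneg _))]
      have h1 : ∫⁻ y, ENNReal.ofReal (Vr y * ∫ x, |f x| ∂(κ t y)) ≤
          ENNReal.ofReal (Real.exp (ϑ * γ * (T_L + T_R) * t)) *
            ∫⁻ x, ENNReal.ofReal |f x| * ENNReal.ofReal (Vr x) := by
        refine le_trans (lintegral_mono fun y => le_of_eq ?_) hsl
        rw [ENNReal.ofReal_mul (hV0 y).le, ofReal_integral_eq_lintegral_ofReal (hfi y)
          (Eventually.of_forall fun x => abs_nonneg _)]
      exact lt_of_le_of_lt h1 (ENNReal.mul_lt_top ENNReal.ofReal_lt_top (lt_top_iff_ne_top.2 hfin))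
    exact hmaj.mono' ((hgm.mul hκf_meas).aestronglyMeasurable) (Eventually.of_forall hbound)
  -- (C) the duality identity `∫ f (P_t g - g) dx = ∫ g (e^{ct} P̂_t f - f) dy`
  have hHint : Integrable (fun p : PhaseSpace N × PhaseSpace N => f p.1 * g p.2)
      ((volume : Measure (PhaseSpace N)) ⊗ₘ P.langevinKernel N T_L T_R t) := by
    haveI : IsMarkovKernel (P.langevinKernel N T_L T_R t) := hP.isMarkovKernel_langevinKernel N T_L T_R t
    have hm : Measurable fun p : PhaseSpace N × PhaseSpace N => f p.1 * g p.2 :=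
      (hfcont.measurable.comp measurable_fst).mul (hgm.comp measurable_snd)
    rw [Measure.integrable_compProd_iff hm.aestronglyMeasurable]
    constructor
    · refine Eventually.of_forall fun x => ?_
      rw [hKl t]
      exact (hgK x).const_mul (f x)
    · have e : (fun x => ∫ y, ‖f x * g y‖ ∂(P.langevinKernel N T_L T_R t x)) =
          fun x => ‖f x‖ * ∫ y, |g y| ∂(K t x) := by
        funext x
        rw [hKl t, ← integral_const_mul]
        exact integral_congr_ae (Eventually.of_forall fun y => by
          simp only [norm_mul, Real.norm_eq_abs])
      rw [e]
      have hm2 : Measurable fun x => ‖f x‖ * ∫ y, |g y| ∂(K t x) :=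
        hfcont.measurable.norm.mul (hgm.abs.stronglyMeasurable.integral_kernel (κ := K t)).measurable
      refine hdom1.mono' hm2.aestronglyMeasurable (Eventually.of_forall fun x => ?_)
      have hI := pinnedChain_abs_integral_transitionKernel_le hω hl hβ hγ hN hTL hTR hϑ hϑ' t x
        (g := fun y => |g y|) (fun y => by rw [abs_abs]; exact hgb y)
      have hI0 : 0 ≤ ∫ y, |g y| ∂(K t x) := integral_nonneg fun y => abs_nonneg _
      have hI' : ∫ y, |g y| ∂(K t x) ≤ Real.exp (Cs * t) * Vr x := (le_abs_self _).trans hI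
      calc ‖‖f x‖ * ∫ y, |g y| ∂(K t x)‖ = ‖f x‖ * ∫ y, |g y| ∂(K t x) := by
            rw [norm_mul, norm_norm, Real.norm_of_nonneg hI0]
        _ ≤ ‖f x‖ * (Real.exp (Cs * t) * Vr x) := mul_le_mul_of_nonneg_left hI' (norm_nonneg _)
  obtain ⟨-, hdualB⟩ := hP.integral_langevinKernel_duality (T_L := T_L) (T_R := T_R) hU hV hN ht hHint
  have hleft : ∫ x, ∫ y, f x * g y ∂(P.langevinKernel N T_L T_R t x) = ∫ x, f x * Kg x := by
    refine integral_congr_ae (Eventually.of_forall fun x => ?_)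
    show ∫ y, f x * g y ∂(P.langevinKernel N T_L T_R t x) = f x * Kg x
    rw [hKl t, integral_const_mul]
  have hright : ∫ y, ∫ x, f x * g y ∂(κ t y) = ∫ y, g y * ∫ x, f x ∂(κ t y) := by
    refine integral_congr_ae (Eventually.of_forall fun y => ?_)
    show ∫ x, f x * g y ∂(κ t y) = g y * ∫ x, f x ∂(κ t y)
    rw [integral_mul_const, mul_comm]
  have hident : ∫ x, f x * (Kg x - g x) = ∫ y, g y * D y := by
    have e1 : ∫ x, f x * (Kg x - g x) = (∫ x, f x * Kg x) - ∫ x, f x * g x := by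
      calc ∫ x, f x * (Kg x - g x) = ∫ x, (f x * Kg x - f x * g x) :=
            integral_congr_ae (Eventually.of_forall fun x => by simp only [mul_sub])
        _ = _ := integral_sub hfKg hfg
    have e2 : ∫ y, g y * D y =
        Real.exp (c * t) * (∫ y, g y * ∫ x, f x ∂(κ t y)) - ∫ x, f x * g x := by
      calc ∫ y, g y * D y = ∫ y, (Real.exp (c * t) * (g y * ∫ x, f x ∂(κ t y)) - f y * g y) :=
            integral_congr_ae (Eventually.of_forall fun y => by simp only [hD]; ring)
        _ = (∫ y, Real.exp (c * t) * (g y * ∫ x, f x ∂(κ t y))) - ∫ y, f y * g y :=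
            integral_sub (hgκf.const_mul _) hfg
        _ = _ := by rw [integral_const_mul]
    rw [e1, e2, ← hleft, hdualB, hright]
  -- (D) conclusion
  have hfinal : |∫ y, g y * D y| ≤ Real.exp (c * t) * (t * (Real.exp (Cs * t) * ∫ x, |E x| * Vr x)) := by
    calc |∫ y, g y * D y| ≤ ∫ y, |g y * D y| := abs_integral_le_integral_abs
      _ ≤ ∫ y, Vr y * |D y| := integral_mono_of_nonneg (Eventually.of_forall fun y => abs_nonneg _) hVDi
          (Eventually.of_forall fun y => by
            show |g y * D y| ≤ Vr y * |D y|
            rw [abs_mul]; exact mul_le_mul_of_nonneg_right (hgb y) (abs_nonneg _))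
      _ = (∫⁻ y, ENNReal.ofReal (Vr y * |D y|)).toReal :=
          integral_eq_lintegral_of_nonneg_ae (Eventually.of_forall fun y =>
            mul_nonneg (hV0 y).le (abs_nonneg _)) hVDi.aestronglyMeasurable
      _ ≤ (ENNReal.ofReal (Real.exp (c * t)) * (t * (ENNReal.ofReal (Real.exp (Cs * t)) *
            ENNReal.ofReal (∫ x, |E x| * Vr x)))).toReal :=
          ENNReal.toReal_mono (ENNReal.mul_ne_top ENNReal.ofReal_ne_top (ENNReal.mul_ne_top
            ENNReal.coe_ne_top (ENNReal.mul_ne_top ENNReal.ofReal_ne_top ENNReal.ofReal_ne_top))) hB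
      _ = _ := by
          have hI0 : 0 ≤ ∫ x, |E x| * Vr x := integral_nonneg fun x => mul_nonneg (abs_nonneg _) (hV0 x).le
          rw [ENNReal.toReal_mul, ENNReal.toReal_mul, ENNReal.toReal_mul, ENNReal.toReal_ofReal (Real.exp_pos _).le,
            ENNReal.toReal_ofReal (Real.exp_pos _).le, ENNReal.toReal_ofReal hI0, ENNReal.coe_toReal]
  rw [hident]
  refine hfinal.trans (le_of_eq ?_)
  simp only [hE, hVr, hLf, hc, hPγ, hCs]
  ring

end Duhamel

/-- Registered helper sub-goal `helper_nessWeightedDuhamel` of stmt-AtomisticToContinuum-11976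
(= `pinnedChain_abs_integral_mul_transitionKernel_sub_le`, fully quantified, notation-free one-line form). -/
theorem helper_nessWeightedDuhamel : ∀ (ω₂ lam β γ : ℝ), 0 < ω₂ → 0 ≤ lam → 0 ≤ β → 0 ≤ γ → ∀ (N : ℕ), 0 < N → ∀ (T_L T_R : ℝ), 0 < T_L → 0 < T_R → ∀ (ϑ : ℝ), 0 < ϑ → ϑ < 1 / max T_L T_R → ∀ (f : Literature.MathematicalPhysics.KineticTheory.HeatConduction.PhaseSpace N → ℝ), ContDiff ℝ 2 f → HasCompactSupport f → ∀ (g : Literature.MathematicalPhysics.KineticTheory.HeatConduction.PhaseSpace N → ℝ), Measurable g → (∀ y, |g y| ≤ Real.exp (ϑ * (Literature.MathematicalPhysics.KineticTheory.HeatConduction.pinnedChain ω₂ lam β γ).hamiltonian N y)) → ∀ (t : NNReal), 0 < t → |MeasureTheory.integral MeasureTheory.volume (fun x => f x * (MeasureTheory.integral ((Literature.MathematicalPhysics.KineticTheory.HeatConduction.pinnedChain ω₂ lam β γ).transitionKernel N T_L T_R t x) (fun y => g y) - g x))| ≤ (t : ℝ) * Real.exp (2 * γ * (t : ℝ)) *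 Real.exp (ϑ * γ * (T_L + T_R) * (t : ℝ)) * MeasureTheory.integral MeasureTheory.volume (fun x => |Literature.MathematicalPhysics.KineticTheory.sdeGenerator (fun z => -(Literature.MathematicalPhysics.KineticTheory.HeatConduction.pinnedChain ω₂ lam β γ).drift N z) ((Literature.MathematicalPhysics.KineticTheory.HeatConduction.pinnedChain ω₂ lam β γ).bathVecL N T_L) ((Literature.MathematicalPhysics.KineticTheory.HeatConduction.pinnedChain ω₂ lam β γ).bathVecR N T_R) f x + 2 * γ * f x| * Real.exp (ϑ * (Literature.MathematicalPhysics.KineticTheory.HeatConduction.pinnedChain ω₂ lam β γ).hamiltonian N x)) :=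
  fun _ _ _ _ hω hl hβ hγ _ hN _ _ hTL hTR _ hϑ hϑ' _ hf hfc _ hgm hgb _ ht =>
    pinnedChain_abs_integral_mul_transitionKernel_sub_le hω hl hβ hγ hN hTL hTR hϑ hϑ' hf hfc hgm hgb ht

end Summit.AtomisticToContinuum.FouriersLaw.Theorems.FixedLengthNoiseContinuity

end
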